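import Mathlib
import HarnessLib
import HarnessLib.Audit
import Summits.NavierStokesRegularity.Statement
import Literature.Analysis.FluidPDE.ContinuousAlignmentTypeI
import Summits.NavierStokesRegularity.NavierStokesRegularity.Theses.TypeILiouville
import Summits.NavierStokesRegularity.NavierStokesRegularity.Theorems.SymmetryModuliCountLiouvilleKillsTypeI
import Summits.NavierStokesRegularity.NavierStokesRegularity.Theorems.ScaledTopAlignmentBulkFatou
import Summits.NavierStokesRegularity.NavierStokesRegularity.Theorems.ScaledTopAlignmentWindowGlueKit
import Summits.NavierStokesRegularity.NavierStokesRegularity.Theorems.ScaledTopAlignmentMostTimesGlueKit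
import HarnessLib.Audit.Status.Attr

/-!
Route: ScaledTopAlignment

DORMANT since 2026-08-29T19:38:13Z (census g0: costume|duplicate of route-NavierStokesRegularity-TypeICertificateLadder; reader census-reader-48-g0) — unstaffed, not closed; items shared with open routes are served there. `ledger route dormant <id> --off` reactivates.

# Route ScaledTopAlignment — a-priori scaled alignment of the top vorticity set plus no Type II
gives Clay A

It suffices to show W3 ∧ GAP″, given the hard core «no Type II blow-up» (shared crux NoTypeII =
stmt-0056 of route TypeILiouville, DECLARED RESIDUAL conjunct — imported, not attacked; the attacked
conjuncts are W3 ∧ GAP″):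
W3 (AprioriScaledTopAlignment) — every classical Leray–Hopf solution from a rapidly decaying datum
has, above a vorticity level M(λ,R,ε) chosen per
solution, its λ-top vorticity set unidirectional UP TO SIGN (sine ≤ ε) within R diffusion lengths
√(ν/|ω(x)|) of each top point; GAP″
(TypeIZoomNonAlignedLimit) — at a Type-I blow-up some parabolic zoom of the vorticity converges
pointwise to a continuous slice that is neither ≡ 0 nor
globally sign-parallel to one fixed vector. Realises nsreg-p3 ROUND-2 (cell ns-regularity-ideate); X
= W3 ∧ NoTypeII [residual] ∧ GAP″.
Lean: `NsregP3.AprioriScaledTopAlignment ∧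
Summit.NavierStokesRegularity.NavierStokesRegularity.Theses.TypeILiouville.TypeIliouvilleNoTypeII ∧
NsregP3.TypeIZoomNonAlignedLimit`

## Assembly
Pure logic over tree theorems once the three cruxes are in hand: TypeILiouville.Assembly_holds
(NoBlowup → Clay A), the slab bound
Theorems.liouvilleKillsTypeI_exists_bound_Icc, and this line's proved lemmas (W3 along the zoom ⇒
pairwise sines → 0 ⇒ limit slice ≡ 0 or globally sign-aligned with Ω(y₀) — contradicting GAP″);
kernel-checked as `NsregP3.navierStokesRegularity_of_W3` (cell file ScaledTopAlignment.lean, 545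
lines, standard axioms).

Rationale: WHY THIS LINE. Constantin–Fefferman 1993, Beirão da Veiga–Berselli, Giga–Miura 2011 (Literature fact
`gigaMiura_continuousAlignment_typeI`), Barker–Prange 2020
(arXiv:1906.08225 Thm 3, Rem 15) and Grujić 2009 (doi:10.1007/s00220-008-0726-8) turn COHERENCE OF
THE VORTICITY DIRECTION into regularity as a hypothesis on a FIXED-LEVEL set {|ω| > d}: with a
physical modulus (CF93, Beirão da Veiga–Berselli, Grujić 2009 Thm 1, BP20 Thm 3 / Rmk 15) and —
nearest to this line — with a VANISHING PARABOLICALLY-SCALED modulus under Type I: Giga–Miura 2011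
Remark 1.4 (CA′) «|ζ(x,t) − ζ(y,t)| ≤ η(o(1)|x−y|/√(−t)) for x, y ∈ Ω_d(t)» [HUPS preprint #956 p.4,
proof §2.1 p.7; CMP 303 (2011); cell LIT-PACK §R21
renders/GM11-HokkaidoPreprint956-full/page-04.txt, page-07.txt]. W3 differs from (CA′) in four typed
respects, each forced by the cell's pre-registered DNS audit (DIRCOH-1/1b, KYP enstrophy-optimal
family E1000–E8000): (i) TOP-SET ONLY — the partner must lie in the λ-top set relative to the local
value |ω(x)| (no fixed level d); (ii) SIGN-BLIND (sine) — the signed version is false on that family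
at every level (anti-parallel partner at 5–9 ℓ); (iii) AMPLITUDE-DEFINED radius R√(ν/|ω(x)|), stated
WITHOUT Type I; (iv) a fixed ε at fixed (λ,R) with a threshold M per solution instead of an o(1)
modulus. Logical placement: the FIXED-modulus hypothesis (CA) [CF93; GM11 Thm 1.1 (HUPS #956 p.3)]
implies W3 outright (given λ, R, ε take M ≥ d/λ with η(R√(ν/M)) below the sine tolerance), so W3 is
strictly weaker than (CA); with the SCALED hypothesis (CA′) it is INCOMPARABLE — on Type-I solutions
(CA′) yields W3's conclusion for pairs within any fixed similarity radius A√(T−t) (the near-maximum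
part of the top set, where |ω(x)| ≍ (T−t)⁻¹; the matching vorticity-rate floor is not located in
print, cell lit PRECISION 19:38:37Z), but at points with M ≤ |ω(x)| ≪ ‖ω(t)‖_∞ (profile tails) W3's
amplitude radius R√(ν/|ω(x)|) exceeds every similarity radius as t ↑ T, where (CA′) says nothing,
while conversely W3 is sign-blind and level-free where (CA′) is not; the scaled sine-incoherence of
the top set during amplification falls with the level in the audit (0.074 → 0.051 → 0.032). The
import from geometry/analysis is the Type-I zoom (Seregin–Šverák 2009) plus the planar
Liouville theorem KNSS 2009 Thm 5.1 (tree `KNSS2009_liouville_planar_holds`) through nsreg-p1's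
kernel engine `typeIProfile_alignedWindow_zero`: scaled
alignment passes to the blow-up limit (proved: `scaledAlignmentPassesToLimit_holds`,
`sine_tendsto_zero_of_scaledTopAligned`) and an aligned window kills the
profile. Versus the tree's ContinuousAlignment route (stmt-18585/18584): W1 ⇒ W3 is proved
(`scaledTopAlignment_of_aprioriContinuousAlignment`) and W3 is
strictly weaker (it tolerates the anti-parallel partner at 5–9 ℓ seen in every DNS leg); versus the
negatives index: no refuted statement is re-asked (W3
quantifies M per solution; GAP″ is a zoom DICHOTOMY, not a Liouville claim). DOOR CHANGE (rev 3,
ROUND-3 of the cell, referee PASS SCORE-ROUND-3-p3): the registered DNS falsifier of W3's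
finite-level POINTWISE proxy FIRED on the reconnecting-tube family X90 at level R2 (DIRCOH-2 =
PREREG-3: growth-window G3 = 0.58 / 0.63 > 0.45 at N256/N384, G1 0.035 → 0.194 rising with level),
while the BULK column stayed in its band (G2 0.017 → 0.034) and the adversarial high-symmetry Kida
family at K500 is one-directional in the bulk (DIRCOH-3: G2 = 0.000, verdict H_align, falsifier not
fired); so the load-bearing a-priori crux is now the strictly weaker BULK/MEASURE form W3′
(AprioriScaledBulkAlignment: the ε-misaligned part of the relative top set in the scaled ball has
measure ≤ δ·(ν/|ω(x)|)^{3/2}), which is exactly what the proved Fatou upgrade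
`Theorems.dirSine_limit_eq_zero_of_scaledBulkAligned` (p418769) consumes; W3 ⇒ W3′ (empty
exceptional set; cell BulkAlignment.lean `bulk_of_top`), and W3 stays in the file as a banked ASIDE
(stronger variant, never staffed). DOOR CHANGE 2 (rev 7, cell ROUND-4/5 + RESULT-5): the registered
near-max ladder (PREREG-5) found the BULK incoherent fraction of the λ=0.7071 relative top set
inside the W-band at every level of record (K500 .000; G400 N2(.7071) .014 vs N2(.5) .112; G800 .002
vs .115; NEARMAX_W ×3, gated) while the POINTWISE near-max statistics stay incoherent (N3(.7071) .94
→ .56): the finite-level support is for a BULK statement restricted to the RATE WINDOW near the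
maximum, which is also exactly what the glue consumes (the parabolic Type-I zoom sees only points
with (T−t)|ω| bounded below). Hence the load-bearing a-priori crux becomes W3ʷᵇ =
AprioriWindowBulkAlignment (∃ λ₀ < 1, R₀ > 0; bulk clause of W3′ only at points with κ/(T−t) ≤
|ω(t,x)|, every κ > 0): W3′ ⇒ W3ʷᵇ (cell WindowBulk.lean `windowBulk_of_bulk`, λ₀ = ½, R₀ = 1),
glued by `closes : W3ʷᵇ → GAP‴ → NoTypeII → NavierStokesRegularity` (p5 g2's re-glue package
REGLUE-W3wb.md: the THESES-FREE kit `Theorems.ScaledTopAlignmentWindowGlueKit` p430118,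
`false_of_windowBulkAligned_parabolicZoom` = window-Fatou at the parabolic scale + p6's landed
open-set rigidity `LocalSineTubeDoorProfileAlignedWindowRigidity.eq_zero_of_aligned_window` +
Giga–Miura's unidirectional Liouville for the vorticity-free slice; the cell's independent inlined
variant rev7/Glue7Spec.lean `closes7` checks the same architecture), where GAP‴ =
TypeIParabolicZoomLimit is the Type-I zoom stated in PARABOLIC form (λⱼ²(−s) = ν(T−tⱼ), tⱼ → T —
GAP″ exposes no scale/time law, so a RATE-window door cannot be fed from it) = VERBATIM the
conclusion of the tree theorem `Theorems.typeIZoom_ancientMild_limit_parabolic` (p420720), i.e.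
proved by name in one line once the item exists; W3′ (19438) and W3 (19901) stay as banked ASIDES
(stronger variants), GAP″ (19902, proved) is no longer a binder. DOOR CHANGE 3 (rev 11–14, cell
ROUND-5/ROUND-7 §3 + nsreg-p5 g3 kit): the a-priori door is weakened in TIME to W3ᵐᵗ =
AprioriMostTimesBulkAlignment (stmt-19551): W3ʷᵇ’s window clause demanded only at times t ∉ E, for
an exceptional set E of final density ≤ θ < 1 at T (∃ λ₀, R₀, θ uniform; M and E per κ, ε, δ).
Reasons: (i) the only a-priori GEOMETRIC estimate in print (Constantin’s budget, below) is
TIME-INTEGRATED, so any door it could ever feed is a most-times door; (ii) the registered DNS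
statistics (growth-window medians over snapshots) are most-times proxies; (iii) the glue loses
nothing — p5 g3’s Theses-free kit `Theorems.ScaledTopAlignmentMostTimesGlueKit` chooses the zoom
times itself: a FLEXIBLE parabolic zoom (caller-chosen tⱼ → T, λⱼ² = ν(T−tⱼ)/c, window slice s =
−c), a NON-UNIDIRECTIONAL END of the Type-I limit (slices s ∈ [−1,0) cannot all be
unidirectional-or-zero: backward uniqueness + Giga–Miura + real-analytic unique continuation, p6
tools), a slice-selection lemma (density θ < 1 ⇒ for every c ∈ (0,1] and h₀ some t ∈ (T−h₀,T) ∖ E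
with (T−t) ↦ slice −c at a dense set of levels), the one-time window lemma of the rev-7 kit, and
p6’s `eq_zero_of_aligned_window`; `closes : W3ᵐᵗ → NoTypeII → NavierStokesRegularity` is the kit
bridge `navierStokesRegularity_of_mostTimesWindowBulkAlignment_of_noTypeII` by name (GAP‴ 19596,
proved p432339, is no longer a binder; W3ʷᵇ 19447 becomes a banked ASIDE, W3ʷᵇ ⇒ W3ᵐᵗ with E = ∅).
Executed on GLUE grounds (ROUND-7 §3) with the caveat that the proxy’s time structure is decided
only by PREREG-7 / RESULT-6 §7. LADDER CEILING (cell ROUND-5 §2, BC9): the only a-priori GEOMETRIC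
estimate in print, Constantin 1990 (Literature fact
`Literature.Analysis.FluidPDE.constantin1990_direction_dissipation_bound`,
ConstantinDirectionDissipation.lean; doi:10.1007/bf02096982 (2.20), Thm 2.1/2.2; the |ω|-equation
gives ν∫∫|ω||∇ξ|² ≤ ‖ω₀‖₁ + ‖u₀‖₂²/(√2ν)), prices a misaligned near-max core at zero in general
(direction may turn across |ω|-dips) and at c ν^{3/2}|ω|^{1/2} per unit time for full cores —
affordable at ALL times under the Type-I window; a weight-|ω|^{1+s} budget would exclude it iff s ≥
½, the a-priori side stops at weight 1, regularity is weight 2: method_family a-priori geometric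
budgets, ladder_ceiling capped-at-weight-|ω|¹, ceiling_lift = a near-max-core bound on
ν∫∫|ω|^{3/2}|∇ξ|² (none known) — the door cruxes are genuine hypotheses, not reachable from the
a-priori side.

RANKED CRUXES. #2 AprioriMostTimesBulkAlignment (crux, LOAD-BEARING, stmt-19551) — W3ᵐᵗ — a-priori
MOST-TIMES window bulk alignment: there are λ₀ < 1, R₀ > 0 and θ < 1 such that for every rate
constant κ > 0 and all ε, δ > 0 some threshold M and some exceptional time set E with |E ∩ (T−h,T)|
≤ θh for all small h work: at every time t ∈ [0,T) ∖ E, around every point x with |ω(t,x)| ≥ M AND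
κ/(T−t) ≤ |ω(t,x)| the ε-misaligned (sign-blind sine) part of {|ω(y)| ≥ λ₀|ω(x)|} inside |x−y| ≤
R₀√(ν/|ω(x)|) has Lebesgue measure ≤ δ(ν/|ω(x)|)^{3/2}, for every classical Leray–Hopf solution from
a rapidly decaying datum on [0,T) (VERBATIM the hypothesis of
`navierStokesRegularity_of_mostTimesWindowBulkAlignment_of_noTypeII`). [difficulty: open-problem]
(why it might fail: at a Type-I blow-up the misaligned bulk could recur on time sets of final
density → 1 at every rate scale — Constantin’s budget bounds only a time integral at weight |ω|¹,
and RND7 DNS shows misaligned episodes of ≈×7 growth (G800 φ = .42).) [GigaMiura2011,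
arXiv:1907.01687, doi:10.1007/bf02096982, arXiv:1906.08225]
ASIDE AprioriWindowBulkAlignment — W3ʷᵇ (rev 7–10 load-bearing, stmt-19447): banked stronger variant
(all times), W3ʷᵇ ⇒ W3ᵐᵗ (E = ∅; cell rev11/W3mtRung.lean); its glue (rev 9 `closes` on
`false_of_windowBulkAligned_parabolicZoom` + GAP‴) remains valid text in git history; rungs
W3′/W3/W1 ⇒ W3ʷᵇ and the regular case typed (cell rev7/W3wbRung.lean p432335,
rev7/W3wbRegularCase.lean); never staffed.
ASIDE AprioriScaledBulkAlignment — W3′ (rev 5–6 load-bearing, stmt-19438): banked stronger variant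
(all λ < 1, all R, no rate window), W3′ ⇒ W3ʷᵇ; its own glue (rev 5 `closes` on BulkFatou
`dirSine_limit_eq_zero_of_scaledBulkAligned` + GAP″) remains valid text in git history; never
staffed.
SUPPORT TypeIParabolicZoomLimit — GAP‴ — the Type-I PARABOLIC zoom (binder of closes at rev 7–12;
CLOSED·proved p432339, no longer a binder at rev 13): every Type-I singular classical Leray–Hopf
solution has a non-trivial Type-I ancient mild blow-up limit W, W(−1) 0 ≠ 0, each of whose slice
vorticities curl W(s), s < 0, is the pointwise limit of parabolic vorticity zooms (λⱼ²(−s) =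
ν(T−tⱼ), tⱼ → T). A THEOREM of the tree (`Theorems.typeIZoom_ancientMild_limit_parabolic`, p420720:
Seregin–Šverák zoom p417252 + Oseen slab p416727 + GM11 Prop 2.2 typer p428648) — filed as support,
closes by name. [arXiv:0709.3599, GigaMiura2011]
#3 TypeIZoomNonAlignedLimit (crux, no longer a binder of closes at rev 7) — GAP″ — CLOSED, PROVED BY
NAME:
`Summit.NavierStokesRegularity.NavierStokesRegularity.Theorems.scaledTopAlignment_typeIZoomNonAlignedLimit_proof`
(p417545; zoom `typeIZoom_ancientMild_limit` p417252 + Oseen slab p416727; GM11 Prop 2.2 core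
discharged in Literature p421830). [arXiv:0709.3599, arXiv:1906.08225]
#4 NoTypeII (crux, DECLARED RESIDUAL) — NO TYPE II BLOW-UP: the shared hard core
stmt-NavierStokesRegularity-0056 (TypeILiouville.TypeIliouvilleNoTypeII), attached not re-filed;
tribunal `residual: NoTypeII`. [difficulty: open-problem] (why it might fail: it is the Type-II half
of the millennium problem: Tao's averaged-NS blow-up is Type II and KNSS p.4 makes every
axisymmetric singularity Type II, so Hou's candidate, if real, refutes it.) [arXiv:1402.0290,
arXiv:0709.3599, arXiv:2107.06509]
ASIDE AprioriScaledTopAlignment — W3 (pointwise form; rev 1–2 load-bearing crux stmt-19901): banked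
stronger variant, W3 ⇒ W3′; its finite-level pointwise proxy was refuted on X90/R2 by the registered
falsifier (RESULT-2 §6), its (CA)-side rungs are tree theorems
(Theorems/ScaledTopAlignmentW3Rung.lean: `scaledTopAlignmentAt_of_continuousAlignmentAt`,
`aprioriScaledTopAlignment_of_aprioriContinuousAlignment` = W1 ⇒ W3 from route ContinuousAlignment
stmt-18585, `scaledTopSine_le_nearMax_of_scaledAlignment`), kept because three tree modules name the
decl; never staffed. Assembly (stmt-19903) is PROVED BY NAME:
`Summit.NavierStokesRegularity.NavierStokesRegularity.Theorems.scaledTopAlignment_assembly_proof`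
(p418117).

TWO-LAYER PLAN. none active: GAP″'s registered skeleton (GapSkeleton2.lean, Z → U) is superseded by
its proof. For W3ᵐᵗ no split is proposed before a prover line exists; the foreseeable glued split
(inherited from W3′) is ⇐ (near-maximum part: points with |ω(t,x)| ≥ θ‖ω(t)‖∞, where under Type I
the proved (CA′)-machinery `gigaMiura2011_scaledAlignment_typeI_holds` places the statement) + (tail
part: M ≤ |ω(t,x)| < θ‖ω(t)‖∞, where the amplitude radius exceeds every similarity radius) —
recorded, not filed.

BC5 (witness of weakness). RUNGS IN TREE (p421258, Theorems/ScaledTopAlignmentW3Rung.lean, axioms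
standard): `scaledTopAlignmentAt_of_continuousAlignmentAt` — at ONE solution the fixed-modulus
continuous-alignment hypothesis (CA) on {|ω| > d} (any modulus η → 0⁺; CF93 η(s) = s/ρ, GM11 Thm 1.1
a general modulus under Type I) implies W3's conclusion for every λ, R, ε, hence W3′'s (empty
exceptional set); `aprioriScaledTopAlignment_of_aprioriContinuousAlignment` (W1 ⇒ W3 ⇒ W3′: the crux
sits BELOW the open crux stmt-18585 of route ContinuousAlignment);
`scaledTopSine_le_nearMax_of_scaledAlignment` (the (CA′)+rate-ceiling near-maximum rung). The
(CA)-rung lies OUTSIDE S's known regime because regularity under a general-modulus (CA) without Type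
I is open in print (CF93 needs a Lipschitz-type modulus, Beirão da Veiga–Berselli a Hölder-½ one;
GM11 Thm 1.1 excludes only TYPE-I blow-up under uniform continuity) and it exercises the lever
(direction coherence read at the amplitude radius R√(ν/|ω|)). It is a dominated-side rung; no
decided instance of W3′ on a solution family where (CA) is not assumed exists — the registered
finite-level proxies are numerical (DIRCOH-2/3). Flag expected: T3 rung-by-dominance (or
T3-plan-only with `stub_rung_W3prime_typeI_nearmax : NoTypeII-side Type-I solutions satisfy W3′ at
near-maximum points` via `gigaMiura2011_scaledAlignment_typeI_holds` + GM11 §2.1). REV 13 DOOR —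
RUNGS IN TREE FOR THE CURRENT DECIDING CRUX (p437738, Theorems/ScaledTopAlignmentMostTimesRung.lean,
axioms standard): `mostTimesBulkAlignedAt_of_continuousAlignmentAt` = the T3 witness BY NAME ((CA)
at one solution ⇒ W3ᵐᵗ’s conclusion at that solution),
`aprioriMostTimesBulkAlignment_of_aprioriContinuousAlignment` (W1 ⇒ W3ᵐᵗ: the crux sits below the
open crux stmt-18585), and W3 / W3′ / W3ʷᵇ ⇒ W3ᵐᵗ (`…_of_aprioriScaledTopAlignment`,
`…_of_aprioriScaledBulkAlignment`, `…_of_aprioriWindowBulkAlignment`); W3ʷᵇ’s own rungs and regular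
case landed too (p432335 …WindowBulkRung, p436927 …WindowBulkRegularCase); the regular case of W3ᵐᵗ
(classical extension past T ⇒ the door at u with E = ∅; W3ᵐᵗ ⇔ W3ᵐᵗ at first blow-up times) is typed
rc 0 by name in cell rev11/W3mtRegularCase.lean (to land).

KILL CRITERIA. A refutation of AprioriMostTimesBulkAlignment needs ONE classical Leray–Hopf solution
from a rapidly decaying datum with unbounded vorticity on [0,T) carrying, at rate-near-maximum
points of arbitrarily large |ω| and on time sets of final upper density 1 at T (defeating every θ <
1), a positive scaled-volume fraction of ε-misaligned relative-top-set vorticity for EVERY choice of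
λ₀ < 1, R₀ > 0 — a blow-up of a specific geometry: on the Lean side the route dies with N0 itself.
On the registered numerical side the line is WITHDRAWN (not refuted) if PREREG-6’s falsifier F-6
fires (DIRCOH-4: NEARMAX G1600 = NEARMAX_X gated, or BULKTOP-TREND RND7 = RISES with
N2(.7071)(G1600) > 0.050) or F-6K fires (NEARMAX K1000d = NEARMAX_X), and the MOST-TIMES reading
specifically is withdrawn if PREREG-7’s F-7 fires (misaligned-time fraction φ(G1600) ≥ ½ with
MTTREND = RISES, sha 3503faa6…); the cell then stops advocating the near-max / most-times bulk doors
as finite-level supported and says so here. A refutation of NoTypeII is ¬(Clay A) (Type-II blow-up)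
and kills every regularity route.

NOT DECOMPOSED YET. NoTypeII (hard core, staffed on route TypeILiouville / ThreadingFlux); W3ᵐᵗ
itself (no prover line registered; the a-priori side has no known input beyond Constantin’s
weight-|ω|¹ budget — BC9 ceiling). Banked alternatives typed by the cell: the θ-before-κ uniform
door (MostTimes3.lean) and a same-slice glue needing Dong–Zhang spatial analyticity
(rev11/K-SPEC.md) — superseded by p5’s diagonal-over-levels kit, not filed.

CHEAPEST FALSIFIER. DIRCOH-4 (PREREG-6 sha 3a80dfc3…, frozen 2026-08-26T06:48Z, + PREREG-7
most-times addendum sha 3503faa6…, frozen 08:01Z; legs kit j251639 RND1600-N512 (record), j251641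
RND1600-N384, j251642 KIDA1000-N512d, j251644 KIDA1000-N384d; frozen readers
dircoh-3/growth_window3.py 0ae863a4…, dircoh-3/nearmax6.py a75d5c3d…, dircoh-4/tools/mosttimes7.py
9c5f551f…; assembler dircoh-4/tools/mk_result6.py): F-6 / F-6K / F-7 as above; cost 0 (jobs running,
results ≈ 2026-08-27T02Z).

NUMBERS. DIRCOH-1 (KYP anti-parallel family, E1000/E4000/E8000@256): growth-window G1 = 0.074 /
0.051 / 0.032, G2 = 0.033 / 0.003 / 0.002, G3 = 0.41 / 0.33 / 0.34. DIRCOH-2 (X90 reconnecting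
tubes, of record): R1 G1 .035 · G2 .017 · G3 .37 (H_plateau); R2 G1 .194 · G2 .034 · G3 .63 (SPLIT,
pointwise falsifier FIRED at both grids). DIRCOH-3 (of record): RND7 G400 G1 .563 · G2 .112 · G3 .94
(H_incoh, non-diagnostic by scope); G800 G1 .317 · G2 .115 (H_incoh; BULK_AMBIG); KIDA K500 G1 .136
· G2 .000 · G3 .34 · G5 15.0 ℓ (H_align, falsifier not fired); K1000 VOID of record (LK2 =
KIDA1000-N512 deposited 08:37Z: record growth window 5 < 8 snapshots; informational G1 .032 · G2
.003; RESULT-3 FINAL a97140ab…), TREND KIDA VOID. PREREG-7 dry run on DIRCOH-3 data (informational):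
misaligned-time fraction φ = K500 .00 / G400 .36 / G800 .42. PREREG-5 near-max ladder (RESULT-5, of
record ×3): N2(.7071) K500 .000 / G400 .014 / G800 .002 vs N2(.5) .000 / .112 / .115 (NEARMAX_W ×3,
gated); pointwise N3(.7071) .34 / .94 / .56 (incoherent). Periodic box, Re_Γ ≤ 2000, two grids per
level — an indication where to spend prover time, not evidence about ℝ³ blow-up.

DEFINITION REQUESTS. none

Novelty: Searches RUN: (rev 1–2) lit search --hybrid ×2, lit vsearch ×2, lit galaxy --star all (null ×2),
OpenAlex/S2 (429). Nearest prior art FOUND: Giga–Miura 2011 Remark 1.4 (CA′) [corpus: cell LIT-PACK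
§R21, renders/GM11-HokkaidoPreprint956-full/page-04.txt (statement), page-07.txt (§2.1 proof); CMP
303:289–300 (2011)] = vanishing parabolically-scaled modulus on {|ω| > d} under Type I — nearest on
the 'scaled' axis and the BC9 ceiling; Grujić 2009 Thm 1 [corpus:paper:doi-10-1007-s00220-008-0726-8
p6] (½-Hölder coherence on a FIXED parabolic cylinder), Barker–Prange 2020 Thm 3 + Rem 15
[corpus:paper:arxiv-1906.08225 p18] (physical modulus η on a scaled cone with fixed d), Grujić 2026
[corpus:paper:arxiv-2607.08866 p1,p3]; Grujić et al. 2025 «On taming Moffatt-Kimura vortices of doom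
in the viscous case» [corpus:paper:arxiv-2511.00725 p2 abstract, p3 L47–49, p4 L19] (mean
oscillation of the direction in weighted local bmo on super-level sets ⇒ sparseness); tree route
ContinuousAlignment (stmt-18585/18584). Delta: (CA′) restricted to the λ-top set, made sign-blind,
with the amplitude radius √(ν/|ω(x)|) and no Type-I clause in the statement (strictly weaker than
the fixed-modulus (CA) of CF93/GM11 Thm 1.1, INCOMPARABLE with (CA′) — see «Why this line»;
arXiv:2511.00725 measures mean oscillation in fixed-weight local bmo and concludes sparseness, not a
Liouville contradiction) — this exact statement is not in print, and its in-kernel composition with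
NoTypeII [residual] + the zoom dich  [refs: 10.1512/iumj.2004.53.2415, 2511.00725, paper:doi-10-1007-s00220-008-0726-8, paper:arxiv-1906.08225, paper:arxiv-2607.08866, paper:arxiv-2511.00725, doi:10.1512/iumj.2004.53.2415, paper:doi-10-1007-s00220-010-1000-4]

Barriers (technique_class: vorticity-direction, rescaling-compactness, Liouville): - technique_class: vorticity-direction, rescaling-compactness (blow-up zoom), abstract-liouville,
type-I-exclusion
- Literature.Barriers.NavierStokesRegularity.TaoAveragedBlowup: outside —
(AprioriScaledTopAlignment, GAP″) the lever is Constantin–Fefferman geometric depletion of the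
stretching ω·∇u ξ·ξ under direction coherence, a property of the TRUE nonlinearity's vorticity
transport that Tao's averaged bilinear operator does not share (its 'vorticity direction' is not
transported coherently), so the averaged blow-up does not model a W3-violating or W3-satisfying
solution either way; (NoTypeII) inside — Tao's averaged blow-up is Type II (arXiv:1402.0290 p.8
fn.), which is exactly why NoTypeII is the declared residual hard core and not attacked here.
- Literature.Barriers.NavierStokesRegularity.AveragedTypeIBlowup: (AprioriScaledTopAlignment, GAP″)
outside for the same reason — both are statements about the pointwise vorticity direction field of
the true equation, which the averaged Type-I construction does not carry; (NoTypeII) residual.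
- Literature.Barriers.NavierStokesRegularity.EnergySupercriticality: outside — the lever is the
geometric depletion of ω·∇u under direction coherence (Constantin–Fefferman), a property of the true
nonlinearity that Tao's averaged equation does not share; no supercritical energy-class estimate is
claimed.
- Literature.Barriers.NavierStokesRegularity.AxisymmetricTypeIExclusion: it does not bite W3/GAP″
(they are Type-I-side statements used to

History (route lifecycle, newest last):
- 2026-08-26T10:06:06Z · rev 12: restated AprioriMostTimesBulkAlignmentD (stmt-NavierStokesRegularity-19546) — tenure rev 11 step 1b (nsreg-p3): REPAIR of step 1 — the add carried stale keys (decl_name/statement of the banked θ-after-κ variant D); restate 1:1 (item minut (planner-ns-regularity-ideate-p3-g3-0)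
- 2026-08-29T19:38:13Z · DORMANT — census g0: costume|duplicate of route-NavierStokesRegularity-TypeICertificateLadder; reader census-reader-48-g0 (operator:999:1479886)

sub-problem: NavierStokesRegularity · status: dormant · opened planner-ns-regularity-ideate-p3-g1-0 2026-08-25T20:35:47Z · rev 20 · ledger route-NavierStokesRegularity-ScaledTopAlignment
GENERATED by the gate from the ledger (D-0016/17). Provers cite these decls: `theorem foo : Summit.NavierStokesRegularity.NavierStokesRegularity.Theses.ScaledTopAlignment.<Decl> := …` in Summits/NavierStokesRegularity/NavierStokesRegularity/Theorems/<Name>.lean.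
-/

namespace Summit.NavierStokesRegularity.NavierStokesRegularity.Theses.ScaledTopAlignment

open scoped BigOperators Topology Manifold Classical MeasureTheory ProbabilityTheory Matrix InnerProductSpace ComplexConjugate ContinuousMap
open Filter Set Function TopologicalSpace MeasureTheory

attribute [summit_statement] _root_.NavierStokesRegularity

open Literature.NS

/-- item stmt-NavierStokesRegularity-19551 · crux · rank 1 · open · by planner
why it might fail: At a Type-I blow-up the misaligned bulk could recur on time sets of final density → 1 at every rate scale (no θ<1): Constantin's budget ν∫∫|ω||∇ξ|² bounds only a time integral, and RND7 DNS shows misaligned episodes up to ≈×7 growth (G800 φ = .42); PREREG-7 decides the proxy.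
sources: GigaMiura2011, arXiv:1907.01687, doi:10.1007/bf02096982
[aside → crux r2 at the door change] W3ᵐᵗ «a-priori MOST-TIMES window bulk alignment» (θ-form): for
every classical Leray–Hopf solution from a rapidly decaying datum on [0,T) there are λ₀<1, R₀>0 and
a density fraction θ<1 such that for all κ, ε, δ > 0 some amplitude M and some exceptional time set
E of FINAL DENSITY ≤ θ at T (|E ∩ (T−h,T)| ≤ θh for small h) work: at every t ∈ [0,T) \ E, W3ʷᵇ's
window-bulk clause holds (ε-misaligned part of the λ₀-relative top set within R₀ℓ of a rate-near-max
point κ/(T−t) ≤ |ω(t,x)| ≥ M has measure ≤ δℓ³, ℓ = √(ν/|ω(t,x)|)). VERBATIM the hypothesis of p5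
g3's kit bridge navierStokesRegularity_of_mostTimesWindowBulkAlignment_of_noTypeII
(Theorems/ScaledTopAlignmentMostTimesGlueKit); implied by ROUND-5's θ=½ form (MostTimes.lean l.46)
and by W3ʷᵇ (E = ∅). ROUND-5/6/7: the only a-priori geometric estimate (Constantin's direction
budget) is time-INTEGRATED, and the DNS proxies are growth-window statistics — a most-times door is
what they can support; PREREG-7 registers its proxy φ. -/
@[route_item "route-NavierStokesRegularity-ScaledTopAlignment", crux]
def AprioriMostTimesBulkAlignment : Prop :=
  ∀ (ν T : ℝ), 0 < ν → 0 < T → ∀ (u : ℝ → EuclideanSpace ℝ (Fin 3) → EuclideanSpace ℝ (Fin 3)) (p : ℝ → EuclideanSpace ℝ (Fin 3) → ℝ), Literature.Analysis.FluidPDE.IsClassicalNSSolutionOn (Set.Ico 0 T) ν 0 u p → Literature.Analysis.FluidPDE.IsLerayHopfOn T ν 0 (u 0) u → Literature.Analysis.FluidPDE.HasRapidSpatialDecay (u 0) → ∃ lam0 : ℝ, lam0 < 1 ∧ ∃ R0 : ℝ, 0 < R0 ∧ ∃ θ : ℝ, θ < 1 ∧ ∀ κ : ℝ, 0 < κ →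 ∀ ε : ℝ, 0 < ε → ∀ δ : ℝ, 0 < δ → ∃ M : ℝ, 0 < M ∧ ∃ E : Set ℝ, (∃ h0 : ℝ, 0 < h0 ∧ ∀ h : ℝ, 0 < h → h < h0 → MeasureTheory.volume (E ∩ Set.Ioo (T - h) T) ≤ ENNReal.ofReal (θ * h)) ∧ ∀ t ∈ Set.Ico 0 T, t ∉ E → ∀ x : EuclideanSpace ℝ (Fin 3), M ≤ ‖Literature.Analysis.FluidPDE.curl (u t) x‖ → κ / (T - t) ≤ ‖Literature.Analysis.FluidPDE.curl (u t) x‖ → MeasureTheory.volume {y : EuclideanSpace ℝ (Fin 3) | lam0 * ‖Literature.Analysis.FluidPDE.curl (u t) x‖ ≤ ‖Literature.Analysis.FluidPDE.curl (u t) y‖ ∧ ‖x - y‖ ≤ R0 * Real.sqrt (ν / ‖Literature.Analysis.FluidPDE.curl (u t) x‖) ∧ ε < Real.sqrt (1 - (inner ℝ (‖Literature.Analysis.FluidPDE.curl (u t) x‖⁻¹ • Literature.Analysis.FluidPDE.curl (u t) x) (‖Literature.Analysis.FluidPDE.curl (u t) y‖⁻¹ • Literature.Analysis.FluidPDE.curl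 (u t) y)) ^ 2)} ≤ ENNReal.ofReal (δ * Real.sqrt (ν / ‖Literature.Analysis.FluidPDE.curl (u t) x‖) ^ 3)

/-- item stmt-NavierStokesRegularity-19902 · crux · rank 3 · closed · proved by Summit.NavierStokesRegularity.NavierStokesRegularity.Theorems.scaledTopAlignment_typeIZoomNonAlignedLimit_proof (prover) · by planner
why it might fail: pointwise vorticity convergence of the KNSS Prop 6.1 zoom at a chosen slice, and excluding slice-wise unidirectional KNSS limits with a slice-dependent line (Giga–Miura 2D reduction + KNSS Thm 5.2 = tree KNSS2009_liouville_planar_holds + Type-I decay + uniqueness of bounded mild solutions).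
sources: arXiv:0709.3599, arXiv:1906.08225
[crux] GAP″ — for a classical Leray–Hopf solution with slab L∞ bounds and Type I at T that does not
extend past T, some zoom (moving centres xⱼ, times tⱼ ∈ [0,T), scales λⱼ → 0⁺) of the vorticity
converges pointwise to a continuous Ω that is neither identically zero nor GLOBALLY sign-parallel to
one fixed non-zero vector (no window / unique-continuation form needed: the deciding theorem
supplies global sign-alignment on all of ℝ³). [difficulty: M] -/
@[route_item "route-NavierStokesRegularity-ScaledTopAlignment"]
def TypeIZoomNonAlignedLimit : Prop :=
  ∀ (ν T : ℝ), 0 < ν → 0 < T → ∀ (u : ℝ → EuclideanSpace ℝ (Fin 3) → EuclideanSpace ℝ (Fin 3)) (p : ℝ → EuclideanSpace ℝ (Fin 3) → ℝ), Literature.Analysis.FluidPDE.IsClassicalNSSolutionOn (Set.Ico 0 T) ν 0 u p → Literature.Analysis.FluidPDE.IsLerayHopfOn T ν 0 (u 0) u → (∀ T' < T, ∃ M : ℝ, ∀ t ∈ Set.Icc 0 T', ∀ x, ‖u t x‖ ≤ M) → Literature.Analysis.FluidPDE.IsTypeIBlowup u T → ¬ Literature.Analysis.FluidPDE.HasSmoothExtensionPast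 ν 0 u T → ∃ (xc : ℕ → EuclideanSpace ℝ (Fin 3)) (t : ℕ → ℝ) (lam : ℕ → ℝ) (Ω : EuclideanSpace ℝ (Fin 3) → EuclideanSpace ℝ (Fin 3)), (∀ j, t j ∈ Set.Ico 0 T) ∧ (∀ j, 0 < lam j) ∧ Filter.Tendsto lam Filter.atTop (nhds 0) ∧ Continuous Ω ∧ (∀ y, Filter.Tendsto (fun j => (lam j ^ 2 / ν) • Literature.Analysis.FluidPDE.curl (u (t j)) (xc j + lam j • y)) Filter.atTop (nhds (Ω y))) ∧ ¬ (∀ y, Ω y = 0) ∧ ¬ (∃ e : EuclideanSpace ℝ (Fin 3), e ≠ 0 ∧ ∀ y, (inner ℝ (Ω y) e) ^ 2 = ‖Ω y‖ ^ 2 * ‖e‖ ^ 2)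

-- `TypeIZoomNonAlignedLimit` holds: proved by `Summit.NavierStokesRegularity.NavierStokesRegularity.Theorems.scaledTopAlignment_typeIZoomNonAlignedLimit_proof` (its module imports this route file, so no `_holds` link can be stated here).

/-- item stmt-NavierStokesRegularity-0056 · crux · rank 4 · open · by planner
why it might fail: it is the Type-II half of the millennium problem: Tao's averaged-NS blow-up is Type II and KNSS p.4 makes every axisymmetric singularity Type II, so Hou's candidate, if real, refutes it.
sources: arXiv:1402.0290, arXiv:0709.3599, arXiv:2107.06509
If a finite-energy classical solution from a rapidly decaying datum has maximal lifespan T<∞ (no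
classical extension past T), then ‖u(t)‖_∞ ≤ C (T−t)^{-1/2} eventually as t↑T (Leray's rate is the
matching lower bound, leray_blowup_rate_top). The hardest and most informative crux: a
counterexample is a Type II singularity, i.e. ¬(Clay A). Known: lower bound c√ν (T−t)^{-1/2} (Leray
1934 §20); L³ must blow up (ESS 2003, Seregin 2012); only triple-log quantitative gain (Tao 2021). -/
@[route_item "route-NavierStokesRegularity-ScaledTopAlignment", crux]
def NoTypeII : Prop :=
  ∀ (ν T : ℝ), 0 < ν → 0 < T → ∀ (u : ℝ → EuclideanSpace ℝ (Fin 3) → EuclideanSpace ℝ (Fin 3)) (p : ℝ → EuclideanSpace ℝ (Fin 3) → ℝ), Literature.Analysis.FluidPDE.IsMaximalSmoothSolution ν 0 u p T → Literature.Analysis.FluidPDE.IsLerayHopfOn T ν 0 (u 0) u → Literature.Analysis.FluidPDE.HasRapidSpatialDecay (u 0) → Literature.Analysis.FluidPDE.IsTypeIBlowup u T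

/-- item stmt-NavierStokesRegularity-19438 · aside · rank 2 · open · by planner
why it might fail: a blow-up keeping, inside the scaled ball around points of comparable-to-maximal vorticity, a positive volume fraction of ε-misaligned top-set vorticity (orthogonal reconnection bridge fused to the contact sheet); generic weakly-amplified fields show a non-decaying bulk fraction G2 ≈ 0.11.
sources: arXiv:1906.08225, doi:10.1007/s00220-008-0726-8, arXiv:2607.08866, GigaMiura2011
[crux] W3′ — a-priori scaled, sign-blind BULK alignment (rev-3 load-bearing door, replaces the
pointwise W3 = AprioriScaledTopAlignment, now aside): for λ∈(0,1), R, ε, δ > 0 there is M (per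
solution) such that around every point x with |ω(t,x)| ≥ M the ε-misaligned part of the relative top
set {|ω(y)| ≥ λ|ω(x)|} inside the scaled ball |x−y| ≤ R√(ν/|ω(x)|) has Lebesgue measure ≤
δ·(√(ν/|ω(x)|))³, for every classical Leray–Hopf solution from a rapidly decaying datum on [0,T);
strictly weaker than W3 (stmt-19901) and W1 (stmt-18585); verbatim the hypothesis hW of the tree
bridge `Theorems.navierStokesRegularity_of_aprioriScaledBulkAlignment_of_noTypeII` (p419158). -/
@[route_item "route-NavierStokesRegularity-ScaledTopAlignment", crux]
def AprioriScaledBulkAlignment : Prop :=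
  ∀ (ν T : ℝ), 0 < ν → 0 < T → ∀ (u : ℝ → EuclideanSpace ℝ (Fin 3) → EuclideanSpace ℝ (Fin 3)) (p : ℝ → EuclideanSpace ℝ (Fin 3) → ℝ), Literature.Analysis.FluidPDE.IsClassicalNSSolutionOn (Set.Ico 0 T) ν 0 u p → Literature.Analysis.FluidPDE.IsLerayHopfOn T ν 0 (u 0) u → Literature.Analysis.FluidPDE.HasRapidSpatialDecay (u 0) → ∀ lam : ℝ, 0 < lam → lam < 1 → ∀ R : ℝ, 0 < R → ∀ ε : ℝ, 0 < ε → ∀ δ : ℝ, 0 < δ → ∃ M : ℝ, 0 < M ∧ ∀ t ∈ Set.Ico 0 T, ∀ x : EuclideanSpace ℝ (Fin 3), M ≤ ‖Literature.Analysis.FluidPDE.curl (u t) x‖ → MeasureTheory.volume {y : EuclideanSpace ℝ (Fin 3) | lam * ‖Literature.Analysis.FluidPDE.curl (u t) x‖ ≤ ‖Literature.Analysis.FluidPDE.curl (u t) y‖ ∧ ‖x - y‖ ≤ R * Real.sqrt (ν / ‖Literature.Analysis.FluidPDE.curl (u t) x‖) ∧ ε < Real.sqrt (1 - (inner ℝ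 (‖Literature.Analysis.FluidPDE.curl (u t) x‖⁻¹ • Literature.Analysis.FluidPDE.curl (u t) x) (‖Literature.Analysis.FluidPDE.curl (u t) y‖⁻¹ • Literature.Analysis.FluidPDE.curl (u t) y)) ^ 2)} ≤ ENNReal.ofReal (δ * Real.sqrt (ν / ‖Literature.Analysis.FluidPDE.curl (u t) x‖) ^ 3)

/-- item stmt-NavierStokesRegularity-19447 · aside · rank 2 · open · by planner
why it might fail: a blow-up whose rate-near-max cores keep, for EVERY window radius R₀ and all times up to T, two comparable-amplitude sheets/tubes at a positive angle filling a fixed volume fraction of the window (orthogonal reconnection AT the maximum, all the way up); no a-priori weight-|ω| budget excludes it.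
sources: arXiv:1906.08225, doi:10.1007/s00220-008-0726-8, doi:10.1007/bf02096982, arXiv:2607.08866, GigaMiura2011
[crux-to-be] W3ʷᵇ — a-priori WINDOW BULK alignment (rate-near-max, sign-blind, ONE comparability
ratio λ₀<1, ONE window radius R₀>0, measure form): for every classical Leray–Hopf solution from a
rapidly decaying datum on [0,T) there are λ₀<1, R₀>0 such that for all κ, ε, δ > 0 some M works: at
every point x with |ω(t,x)| ≥ M and ≥ κ/(T−t), the ε-misaligned part of {|ω(t,y)| ≥ λ₀|ω(t,x)|}
inside |x−y| ≤ R₀ℓ, ℓ=(ν/|ω(t,x)|)^½, has volume ≤ δℓ³. Implied by W3′ (stmt-19438) via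
windowBulk_of_bulk; finite-level proxy NEARMAX_W of record at K500/G400/G800 (RESULT-5). -/
@[route_item "route-NavierStokesRegularity-ScaledTopAlignment", crux]
def AprioriWindowBulkAlignment : Prop :=
  ∀ (ν T : ℝ), 0 < ν → 0 < T → ∀ (u : ℝ → EuclideanSpace ℝ (Fin 3) → EuclideanSpace ℝ (Fin 3)) (p : ℝ → EuclideanSpace ℝ (Fin 3) → ℝ), Literature.Analysis.FluidPDE.IsClassicalNSSolutionOn (Set.Ico 0 T) ν 0 u p → Literature.Analysis.FluidPDE.IsLerayHopfOn T ν 0 (u 0) u → Literature.Analysis.FluidPDE.HasRapidSpatialDecay (u 0) → ∃ lam0 : ℝ, lam0 < 1 ∧ ∃ R0 : ℝ, 0 < R0 ∧ ∀ κ : ℝ, 0 < κ → ∀ ε : ℝ, 0 < ε → ∀ δ : ℝ, 0 < δ → ∃ M : ℝ, 0 < M ∧ ∀ t ∈ Set.Ico 0 T, ∀ x : EuclideanSpace ℝ (Fin 3), M ≤ ‖Literature.Analysis.FluidPDE.curl (u t) x‖ → κ / (T - t) ≤ ‖Literature.Analysis.FluidPDE.curl (u t) x‖ → MeasureTheory.volume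 {y : EuclideanSpace ℝ (Fin 3) | lam0 * ‖Literature.Analysis.FluidPDE.curl (u t) x‖ ≤ ‖Literature.Analysis.FluidPDE.curl (u t) y‖ ∧ ‖x - y‖ ≤ R0 * Real.sqrt (ν / ‖Literature.Analysis.FluidPDE.curl (u t) x‖) ∧ ε < Real.sqrt (1 - (inner ℝ (‖Literature.Analysis.FluidPDE.curl (u t) x‖⁻¹ • Literature.Analysis.FluidPDE.curl (u t) x) (‖Literature.Analysis.FluidPDE.curl (u t) y‖⁻¹ • Literature.Analysis.FluidPDE.curl (u t) y)) ^ 2)} ≤ ENNReal.ofReal (δ * Real.sqrt (ν / ‖Literature.Analysis.FluidPDE.curl (u t) x‖) ^ 3)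

/-- item stmt-NavierStokesRegularity-19901 · aside · rank 2 · open · by planner
why it might fail: a blow-up whose top set keeps two non-(anti)parallel sheets of comparable amplitude within O(√(ν/‖ω‖∞)) of each other — orthogonal-reconnection bridges next to the contact sheet at the vorticity peak (DIRCOH-2/PREREG-3 audits exactly this).
sources: arXiv:1906.08225, doi:10.1007/s00220-008-0726-8, arXiv:2607.08866, arXiv:2511.00725
[crux] W3 — a-priori scaled, sign-blind alignment of the λ-top vorticity set within R·√(ν/|ω(x)|) of
each top point, for every classical Leray–Hopf solution from a rapidly decaying datum on [0,T).
[difficulty: open-problem] -/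
@[route_item "route-NavierStokesRegularity-ScaledTopAlignment", crux]
def AprioriScaledTopAlignment : Prop :=
  ∀ (ν T : ℝ), 0 < ν → 0 < T → ∀ (u : ℝ → EuclideanSpace ℝ (Fin 3) → EuclideanSpace ℝ (Fin 3)) (p : ℝ → EuclideanSpace ℝ (Fin 3) → ℝ), Literature.Analysis.FluidPDE.IsClassicalNSSolutionOn (Set.Ico 0 T) ν 0 u p → Literature.Analysis.FluidPDE.IsLerayHopfOn T ν 0 (u 0) u → Literature.Analysis.FluidPDE.HasRapidSpatialDecay (u 0) → ∀ lam : ℝ, 0 < lam → lam < 1 → ∀ R : ℝ, 0 < R → ∀ ε : ℝ, 0 < ε → ∃ M : ℝ, 0 < M ∧ ∀ t ∈ Set.Ico 0 T, ∀ x y : EuclideanSpace ℝ (Fin 3), M ≤ ‖Literature.Analysis.FluidPDE.curl (u t) x‖ → lam * ‖Literature.Analysis.FluidPDE.curl (u t) x‖ ≤ ‖Literature.Analysis.FluidPDE.curl (u t) y‖ → ‖x - y‖ ≤ R * Real.sqrt (ν / ‖Literature.Analysis.FluidPDE.curl (u t) x‖) → Real.sqrt (1 - (inner ℝ (‖Literature.Analysis.FluidPDE.curl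 (u t) x‖⁻¹ • Literature.Analysis.FluidPDE.curl (u t) x) (‖Literature.Analysis.FluidPDE.curl (u t) y‖⁻¹ • Literature.Analysis.FluidPDE.curl (u t) y)) ^ 2) ≤ ε

/-- item stmt-NavierStokesRegularity-19596 · support · rank 9 · closed · proved by Summit.NavierStokesRegularity.NavierStokesRegularity.Theorems.scaledTopAlignment_typeIParabolicZoomLimit_proof (prover) · by planner
why it might fail: It cannot: it is the statement of the landed theorem typeIZoom_ancientMild_limit_parabolic (p420720); filed only because that module imports the route file (GAP″ proof) and so cannot be cited inside closes.
sources: arXiv:0709.3599, GigaMiura2011, arXiv:1906.08225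
GAP‴ — Type-I PARABOLIC zoom: every Type-I singular classical Leray–Hopf solution on [0,T) (slabwise
bounded, no smooth extension) has a non-trivial Type-I ancient mild limit W with W(−1) 0 ≠ 0 whose
slice vorticities curl W(s), s<0, are pointwise limits of parabolic vorticity zooms (λⱼ²(−s) =
ν(T−tⱼ), tⱼ → T). Verbatim the conclusion of the tree theorem
Theorems.typeIZoom_ancientMild_limit_parabolic (p420720): proved by name. -/
@[route_item "route-NavierStokesRegularity-ScaledTopAlignment"]
def TypeIParabolicZoomLimit : Prop :=
  ∀ (ν T : ℝ), 0 < ν → 0 < T → ∀ (u : ℝ → EuclideanSpace ℝ (Fin 3) → EuclideanSpace ℝ (Fin 3)) (p : ℝ → EuclideanSpace ℝ (Fin 3) → ℝ), Literature.Analysis.FluidPDE.IsClassicalNSSolutionOn (Set.Ico 0 T) ν 0 u p → Literature.Analysis.FluidPDE.IsLerayHopfOn T ν 0 (u 0) u → (∀ T' < T, ∃ M : ℝ, ∀ t ∈ Set.Icc 0 T', ∀ x, ‖u t x‖ ≤ M) → Literature.Analysis.FluidPDE.IsTypeIBlowup u T → ¬ Literature.Analysis.FluidPDE.HasSmoothExtensionPast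 ν 0 u T → ∃ (C : ℝ) (W : ℝ → EuclideanSpace ℝ (Fin 3) → EuclideanSpace ℝ (Fin 3)), Literature.Analysis.FluidPDE.IsTypeIAncientMild C W ∧ W (-1) 0 ≠ 0 ∧ ∀ s < (0 : ℝ), ∃ (xc : ℕ → EuclideanSpace ℝ (Fin 3)) (t : ℕ → ℝ) (lam : ℕ → ℝ), (∀ j, t j ∈ Set.Ico 0 T) ∧ Filter.Tendsto t Filter.atTop (nhds T) ∧ (∀ j, 0 < lam j) ∧ Filter.Tendsto lam Filter.atTop (nhds 0) ∧ (∀ j, lam j ^ 2 * (-s) = ν * (T - t j)) ∧ ∀ y, Filter.Tendsto (fun j => (lam j ^ 2 / ν) • Literature.Analysis.FluidPDE.curl (u (t j)) (xc j + lam j • y)) Filter.atTop (nhds (Literature.Analysis.FluidPDE.curl (W s) y))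

-- `TypeIParabolicZoomLimit` holds: proved by `Summit.NavierStokesRegularity.NavierStokesRegularity.Theorems.scaledTopAlignment_typeIParabolicZoomLimit_proof` (its module imports this route file, so no `_holds` link can be stated here).

/-- item stmt-NavierStokesRegularity-19903 · assembly · rank 1 · closed · proved by Summit.NavierStokesRegularity.NavierStokesRegularity.Theorems.scaledTopAlignment_assembly_proof (prover) · by planner
sources: arXiv:1906.08225
[assembly] AprioriScaledTopAlignment → NoTypeII → TypeIZoomNonAlignedLimit → NavierStokesRegularity -/
@[route_item "route-NavierStokesRegularity-ScaledTopAlignment"]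
def Assembly : Prop :=
  AprioriScaledTopAlignment → NoTypeII → TypeIZoomNonAlignedLimit → NavierStokesRegularity

-- `Assembly` holds: proved by `Summit.NavierStokesRegularity.NavierStokesRegularity.Theorems.scaledTopAlignment_assembly_proof` (its module imports this route file, so no `_holds` link can be stated here).

-- records of items no longer active in this route (dropped / restated):
-- earlier AprioriMostTimesBulkAlignmentD (stmt-NavierStokesRegularity-19546, replaced 2026-08-26T10:06:06Z -> stmt-NavierStokesRegularity-19551): retired by None — ∀ (ν T : ℝ), 0 < ν → 0 < T → ∀ (u : ℝ → EuclideanSpace ℝ (Fin 3) → EuclideanSpace ℝ (Fin 3)) (p : ℝ → EuclideanSpace ℝ (Fin 3) → ℝ), Literature.Analysis.FluidPDE.IsClassicalNSSolutionOn (Set.Ico 0 T) ν 0 u p → Literature.Analysis.FluidPDE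

/-! D-0027 §2.1 — DECIDING THEOREM (planner-authored via `route open/edit --closes-file`; by planner-ns-regularity-ideate-p3-g3-0 2026-08-26T10:13:10Z):
its hypotheses are this route's items and its conclusion the sub-problem Statement (glue_lint), and it elaborates with this file. -/

-- glue13 (nsreg-p3 g3, 2026-08-26 10:0xZ): closes for route-NavierStokesRegularity-ScaledTopAlignment with the MOST-TIMES door W3ᵐᵗ
-- (route decl AprioriMostTimesBulkAlignment = θ-form = hypothesis of the kit bridge verbatim, item ADDED by edit13t.json) and the residual NoTypeII;
-- the flexible zoom, the non-unidirectional end, the slice selection and the window/levels lemma are INSIDE p5 g3's Theses-free kit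
-- Summits.NavierStokesRegularity.NavierStokesRegularity.Theorems.ScaledTopAlignmentMostTimesGlueKit (imported by the route file via edit13t.json).
-- If the kit's bridge name differs, replace it below (p5's LANDED line names it).  Commands:
--   ledger route edit route-NavierStokesRegularity-ScaledTopAlignment --file edit13t.json
--   ledger route check --native --id route-NavierStokesRegularity-ScaledTopAlignment --closes-file glue13t.lean      (expect rc 0, closes OK)
--   ledger route edit route-NavierStokesRegularity-ScaledTopAlignment --closes-file glue13t.lean --note "rev 11: door W3ʷᵇ → W3ᵐᵗ (most-times); closes = p5 kit bridge"
--   ledger route edit route-NavierStokesRegularity-ScaledTopAlignment --retriage retriage13.json --note "retriage: W3ᵐᵗ → crux r2; W3ʷᵇ 19447 → aside[; GAP‴ 19596 → aside]"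
@[closes "route-NavierStokesRegularity-ScaledTopAlignment"] theorem closes (hW : AprioriMostTimesBulkAlignment) (hII : NoTypeII) : _root_.NavierStokesRegularity :=
  Summit.NavierStokesRegularity.NavierStokesRegularity.Theorems.navierStokesRegularity_of_mostTimesWindowBulkAlignment_of_noTypeII hW hII

end Summit.NavierStokesRegularity.NavierStokesRegularity.Theses.ScaledTopAlignment
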